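import Literature.Probability.LatticeModels.PolymerGasGeometric
import Literature.Probability.LatticeModels.PolymerPressure
import Literature.MathematicalPhysics.QuantumFieldTheory.Balaban1983to89.T3MinimiserStabilityReduction
import Summits.QuantumFields.YangMills.Theorems.FluctuationComparisonRegPrIntLS2BetaKPLCriterion
import Summits.QuantumFields.YangMills.Theorems.FluctuationComparisonRegPrIntLPolymerPinAlgebra
import Mathlib.Combinatorics.SimpleGraph.Paths
import HarnessLib

/-!
# KP-ACTIVITY LETTER №1 FOR THE GAS HANDS OF S2β: «GEOMETRIC» activities — V-local, supported on CONNECTED bond polymers, bounded by `E₀·q^{|X|}` on the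
# window — form a Kotecký–Preiss gas `KPGasOn window κ N w` (δ-unfolded) as soon as `(Δ+1)²·q·e^{1+κr} ≤ ½` and `E₀ ≤ min N 1`

Cell `ym3-torus` (YM ladder rung R3 = continuum `SU(2)` Yang–Mills on the three-torus — a RUNG, NOT d = 4, NOT infinite volume, NOT a mass gap, NOT Clay).  Seat `ymfull-r3-prover-2`
(gen 0; R600-ym: hand = the REGISTERED stub `stub_beyondOneLoopSmallIntCan : BeyondOneLoopSmallIntCan`, registry `Cruxes/FluctuationComparisonRegPrIntL/Lines/semiclassical_s2beta.lean`
v11.4; PLAN `Lines/loop_ledger.lean` v6; lane per LEAD w3 g23 №4: «prover-2 = the KP-activity letters»); `--supports stmt-QuantumFields-20520 --as helper`, count-neutral, definition-free,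
default heartbeats; no registry, binder or `Lines/` edit (RULING №36 untouched).

WHAT.  Both gas doors of the S2β table — GAS ∕ GAS₁ `BeyondOneLoopGasCan` ∕ `LoopLedgerDepthOneGasCan` of LINE g19-2 (row 2, through FILES 1–2 of this seat to the registered H4ᶜ∘) and
LFG `LargeFieldGasRepCan` of LINE g19-1 (row 3) — ask the hand for `KPGasOn window κ (Φ J) w`: V-local real activities with a field-uniform majorant `w̄`, lengths `ℓ ≥` source
diameter, a size function `a` with the Kotecký–Preiss inequality `Σ_{X′ ι X} w̄ X′ e^{a X′ + κ ℓ X′} ≤ a X`, and the pinned size `a {e} ≤ Φ J`.  A cluster expansion does not natively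
emit `a` and `ℓ`; it emits activities on CONNECTED localisation domains, exponentially small in their size ([Balaban1987RG1] (0.25) `|E^{(j)}(X,U)| ≤ E₀ e^{−κ d_j(X)}` with
`d_j(X) ≥ c(|X| − 1)` the tree length; [Balaban1989LargeFieldII] (1.100)).  THIS FILE is the letter turning the native output into `KPGasOn`, def-free, over the tree's
animal bound ✓`Literature.Probability.LatticeModels.sum_pow_card_le_of_connected` (`Σ_{Y ∋ q connected} λ^{|Y|} ≤ 2λ` when `(Δ+1)²λ ≤ ½`) and the pinned criterion
✓`…S2BetaKPLCriterion.exists_size_of_pinned_criterion` (KPL-E, pen ym-ust-20520-w3 g15):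
* §1 `dist_le_of_isRConnected` — in an `R`-connected set whose steps have `δ`-length `≤ r` (δ a pseudo-metric), any two members are within `r·(|X| − 1)` (shortest chain =
  simple path in the induced graph, Mathlib `SimpleGraph.Walk.toPath` + `IsPath.length_lt`).
* §2 `pinnedSum_le_of_geometric` — for `w̄ X := E₀ q^{|X|}` on connected `X` (`0` else) and lengths `ℓ X ≤ r|X|` on connected `X`:
  `Σ_{X′ ∋ e} w̄ X′ e^{τ|X′| + κ ℓ X′} ≤ 2E₀λ`, `λ := q·e^{τ + κ r}`, whenever `(Δ+1)²λ ≤ ½`.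
* §3 ★ `kpGas_of_geometric` (generic bond type `B`, field type `B → G`): V-local activities vanishing off connected polymers with `|w_U X| ≤ E₀ q^{|X|}` on `W`, `E₀ ≤ min N 1`,
  `(Δ+1)²·q·e^{1+κr} ≤ ½` ⟹ the eight clauses of `KPGasOn W κ N w` (δ-unfolded; `a X := (min N 1)·|X|`); ★★ `kpGasOn_of_geometric` — the `GaugeField P 0 SU(2)` ∕ `PBond P 0`
  edition with `ℓ X :=` the source-`tdist` diameter of `X` (✓`…PolymerPinAlgebra.cast_dist_le_cast_supDiam`), conclusion = the `KPGasOn` text of `Lines/loop_ledger.lean` v6 §1c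
  token for token — so a GAS₁∘ ∕ LFG hand proves «connected support + `E₀ q^{|X|}` on the window» and cites this door for the gas clause.
Door-fit (HOME cert): `example (h : …) : KPGasOn W κ N w := kpGasOn_of_geometric …` against the pasted v6 text.

SIBLING SPELLING (★★OWNER WORD №197, one engine ∕ two spellings): ✓p786644 `…LargeFieldGasEntropyCriterion.pinned_criterion_of_connected_decay` ∕ `exists_size_of_connected_decay`
(seat ymfull-r3-prover-1 g0, the LFG hand) derive the same `a`-clauses from a `SimpleGraph`-connected support (`(G.induce X).Connected`, `G.degree ≤ Δ`) with the RATE letter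
`w̄ X ≤ δ·e^{−μ|X|}`, `δ + κℓ₀ + 2 log Δ + 1 ≤ μ`, over lit ✓`ncard_connected_finsets_through_le_pow`; this file uses the RELATION spelling (`IsRConnected R`, listed neighbours) with the
PRODUCT letter `w̄ X ≤ E₀·q^{|X|}`, `(Δ+1)²·q·e^{1+κr} ≤ ½`, `E₀ ≤ min N 1`, over lit ✓`sum_pow_card_le_of_connected`, and adds the `KPGasOn` producer with the source-diameter lengths.
The two smallness letters are incomparable (neither implies the other); consumers holding graph-connected supports with `δe^{−μn}` bounds should cite the sibling.

HONEST SCOPE.  Finite combinatorics (animal counting, already in the tree) and bookkeeping; NO activity of Bałaban's expansion is constructed or bounded here — the geometric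
bound `|w_U X| ≤ E₀ q^{|X|}` with `E₀ = O(g_J²)` IS the XL content of GAS₁ ∕ LFG and stays a hypothesis; `BeyondOneLoopSmallIntCan`, the other registered ∘-stubs, S2β and
`FluctuationComparisonRegPrIntL` (stmt-QuantumFields-20520) are NOT proved; no summit statement is proved by a helper; rung R3 = SU(2) YM₃ on T³ — finite volume, conditional;
NOT d = 4, NOT infinite volume, NOT a mass gap, NOT Clay; the Yang–Mills mass gap is NOT proved.

References: T. Bałaban, CMP **109** (1987) 249–301 [Balaban1987RG1] ((0.22)–(0.26) pp.256–257); CMP **122** (1989) 355–392 [Balaban1989LargeFieldII] ((1.97)–(1.100) pp.389–390);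
R. Kotecký, D. Preiss, CMP **103** (1986) 491–498 [KoteckyPreiss1986] (Theorem p.492 (1)); S. Friedli, Y. Velenik, *Statistical Mechanics of Lattice Systems* (2017) §5.7.1
[FriedliVelenik2017]; V. Rivasseau, *From Perturbative to Constructive Renormalization* (1991) §III.1 [Rivasseau1991].
-/

noncomputable section

open Finset Filter Topology Set
open scoped BigOperators
open Literature.Probability.LatticeModels (polymerPartitionFunction polyInc IsRConnected sum_pow_card_le_of_connected)
open Literature.MathematicalPhysics.QuantumFieldTheory.Balaban1983to89

namespace Summit.QuantumFields.YangMills.Theorems.KPGasOfGeometricActivities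

/-! ## §1 Diameter of a connected polymer -/

section Diameter

variable {B : Type*} [DecidableEq B]

/-- **A connected polymer of `n` bonds has `δ`-diameter `≤ r·(n − 1)`** when every `R`-step has `δ`-length `≤ r` (both orientations) and `δ` is a pseudo-metric
(`δ x x ≤ 0`, triangle inequality): the shortest `R`-chain inside `X` is a simple path of the induced graph, of length `< |X|`. [folklore] -/
theorem dist_le_of_isRConnected (R : B → B → Prop) (δ : B → B → ℝ) {r : ℝ} (hr : 0 ≤ r)
    (hδ0 : ∀ x, δ x x ≤ 0) (hδ : ∀ x y z, δ x z ≤ δ x y + δ y z) (hRδ : ∀ x y, R x y → δ x y ≤ r ∧ δ y x ≤ r)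
    {X : Finset B} (hX : IsRConnected R X) {e e' : B} (he : e ∈ X) (he' : e' ∈ X) :
    δ e e' ≤ r * ((X.card : ℝ) - 1) := by
  classical
  -- the induced graph on the subtype `↥X`
  let Gr : SimpleGraph ↥X := SimpleGraph.fromRel fun a b : ↥X => R (a : B) (b : B)
  -- every walk of length `n` joins points within `r·n`
  have hwalk : ∀ (a b : ↥X) (p : Gr.Walk a b), δ (a : B) (b : B) ≤ r * (p.length : ℝ) := by
    intro a b p
    induction p with
    | nil => simpa using hδ0 _
    | @cons u v w hadj p ih =>
      have huv : δ (u : B) (v : B) ≤ r := by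
        have h := (SimpleGraph.fromRel_adj _ _ _).1 hadj
        rcases h.2 with h1 | h1
        · exact (hRδ _ _ h1).1
        · exact (hRδ _ _ h1).2
      calc δ (u : B) (w : B) ≤ δ (u : B) (v : B) + δ (v : B) (w : B) := hδ _ _ _
        _ ≤ r + r * (p.length : ℝ) := add_le_add huv ih
        _ = r * ((SimpleGraph.Walk.cons hadj p).length : ℝ) := by
            simp only [SimpleGraph.Walk.length_cons, Nat.cast_succ]; ring
  -- reachability inside `X` from the `ReflTransGen` clause of `IsRConnected`
  have hreach : ∀ (b : B) (hb : b ∈ X), Relation.ReflTransGen (fun x y => R x y ∧ x ∈ X ∧ y ∈ X) e b →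
      Gr.Reachable ⟨e, he⟩ ⟨b, hb⟩ := by
    intro b hb h
    induction h with
    | refl => exact SimpleGraph.Reachable.refl _
    | @tail c d hcd hstep ih =>
      have hc : c ∈ X := hstep.2.1
      have h1 : Gr.Reachable ⟨e, he⟩ ⟨c, hc⟩ := ih hc
      by_cases hcd' : c = d
      · subst hcd'; exact h1
      · have hadj : Gr.Adj ⟨c, hc⟩ ⟨d, hb⟩ := by
          rw [SimpleGraph.fromRel_adj]
          exact ⟨fun h => hcd' (congrArg Subtype.val h), Or.inl hstep.1⟩
        exact h1.trans hadj.reachable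
  obtain ⟨p⟩ := hreach e' he' (hX.2 e he e' he')
  have hp := hwalk _ _ (p.toPath : Gr.Walk ⟨e, he⟩ ⟨e', he'⟩)
  have hlen : ((p.toPath : Gr.Walk ⟨e, he⟩ ⟨e', he'⟩).length : ℝ) ≤ (X.card : ℝ) - 1 := by
    have h1 := SimpleGraph.Walk.IsPath.length_lt p.toPath.2
    rw [Fintype.card_coe] at h1
    have h2 : ((p.toPath : Gr.Walk ⟨e, he⟩ ⟨e', he'⟩).length : ℝ) + 1 ≤ (X.card : ℝ) := by exact_mod_cast h1
    linarith
  exact hp.trans (mul_le_mul_of_nonneg_left hlen hr)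

end Diameter

/-! ## §2 The pinned sum of geometric activities through a bond -/

section Pinned

variable {B : Type*} [Fintype B] [DecidableEq B]

/-- **PINNED ANIMAL SUM.**  With the majorant `w̄ X = E₀ q^{|X|}` on `R`-connected `X` and `0` elsewhere, lengths `ℓ X ≤ r|X|` on connected `X`, `κ ≥ 0`, and
`λ := q·e^{τ + κr}` satisfying `(Δ+1)²λ ≤ ½` (`Δ` bounding the `R`-neighbour lists): `Σ_{X′ ∋ e} w̄ X′·e^{τ|X′| + κ ℓ X′} ≤ 2E₀λ` — the tree's animal bound
✓`sum_pow_card_le_of_connected` after `e^{τ|X|+κℓX} ≤ (e^{τ+κr})^{|X|}`. [cite: FriedliVelenik2017, §5.7.1; KoteckyPreiss1986, (1)] -/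
theorem pinnedSum_le_of_geometric (R : B → B → Prop) (hRs : ∀ x y, R x y → R y x) (nbr : B → Finset B) (Δ : ℕ)
    (hΔ : ∀ x, (nbr x).card ≤ Δ) (hnbr : ∀ x y, R x y → y ∈ nbr x)
    {E₀ q τ κ r : ℝ} (hE₀ : 0 ≤ E₀) (hq : 0 ≤ q) (hκ : 0 ≤ κ)
    (hsmall : ((Δ : ℝ) + 1) ^ 2 * (q * Real.exp (τ + κ * r)) ≤ 1 / 2)
    (wbar ℓ : Finset B → ℝ) (hwc : ∀ X, IsRConnected R X → wbar X ≤ E₀ * q ^ X.card)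
    (hwn : ∀ X, ¬ IsRConnected R X → wbar X ≤ 0) (hℓ : ∀ X, IsRConnected R X → ℓ X ≤ r * (X.card : ℝ)) (e : B) :
    ∑ X' ∈ Finset.univ.filter (fun X' : Finset B => e ∈ X'), wbar X' * Real.exp (τ * (X'.card : ℝ) + κ * ℓ X')
      ≤ E₀ * (2 * (q * Real.exp (τ + κ * r))) := by
  classical
  set lam : ℝ := q * Real.exp (τ + κ * r) with hlam
  have hlam0 : 0 ≤ lam := mul_nonneg hq (Real.exp_pos _).le
  -- termwise: connected terms `≤ E₀ λ^{|X|}`, the others `≤ 0`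
  have hterm : ∀ X' : Finset B, e ∈ X' → wbar X' * Real.exp (τ * (X'.card : ℝ) + κ * ℓ X')
      ≤ if IsRConnected R X' then E₀ * lam ^ X'.card else 0 := by
    intro X' _
    by_cases hc : IsRConnected R X'
    · rw [if_pos hc]
      have h1 : Real.exp (τ * (X'.card : ℝ) + κ * ℓ X') ≤ Real.exp (τ + κ * r) ^ X'.card := by
        rw [← Real.exp_nat_mul]
        refine Real.exp_le_exp.2 ?_
        have := hℓ X' hc
        nlinarith
      calc wbar X' * Real.exp (τ * (X'.card : ℝ) + κ * ℓ X')
          ≤ (E₀ * q ^ X'.card) * Real.exp (τ + κ * r) ^ X'.card := by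
            refine mul_le_mul (hwc X' hc) h1 (Real.exp_pos _).le ?_
            exact mul_nonneg hE₀ (pow_nonneg hq _)
        _ = E₀ * lam ^ X'.card := by rw [hlam, mul_pow]; ring
    · rw [if_neg hc]
      exact mul_nonpos_of_nonpos_of_nonneg (hwn X' hc) (Real.exp_pos _).le
  -- sum over the connected sets through `e`
  have hsum : ∑ X' ∈ Finset.univ.filter (fun X' : Finset B => e ∈ X'), (if IsRConnected R X' then E₀ * lam ^ X'.card else 0)
      = E₀ * ∑ X' ∈ Finset.univ.filter (fun X' : Finset B => e ∈ X' ∧ IsRConnected R X'), lam ^ X'.card := by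
    rw [Finset.mul_sum, ← Finset.sum_filter, Finset.filter_filter]
  have hanimal : ∑ X' ∈ Finset.univ.filter (fun X' : Finset B => e ∈ X' ∧ IsRConnected R X'), lam ^ X'.card ≤ 2 * lam := by
    have hsmall' : ((Δ : ℝ) + 1) ^ 2 * lam ≤ 1 / 2 := hsmall
    exact sum_pow_card_le_of_connected hRs hΔ hnbr hlam0 hsmall' e _ (fun Y hY => (Finset.mem_filter.1 hY).2)
  calc ∑ X' ∈ Finset.univ.filter (fun X' : Finset B => e ∈ X'), wbar X' * Real.exp (τ * (X'.card : ℝ) + κ * ℓ X')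
      ≤ ∑ X' ∈ Finset.univ.filter (fun X' : Finset B => e ∈ X'), (if IsRConnected R X' then E₀ * lam ^ X'.card else 0) :=
        Finset.sum_le_sum fun X' hX' => hterm X' (Finset.mem_filter.1 hX').2
    _ = E₀ * ∑ X' ∈ Finset.univ.filter (fun X' : Finset B => e ∈ X' ∧ IsRConnected R X'), lam ^ X'.card := hsum
    _ ≤ E₀ * (2 * lam) := mul_le_mul_of_nonneg_left hanimal hE₀

end Pinned

/-! ## §3 The letter: geometric activities form a Kotecký–Preiss gas (generic, then the `SU(2)` bond-polymer edition = `KPGasOn` of LINE g19-2 token for token) -/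

section Letter

variable {B : Type*} [Fintype B] [DecidableEq B]

/-- ★ **GEOMETRIC ACTIVITIES ⟹ THE EIGHT CLAUSES OF `KPGasOn W κ N w` (generic).**  Data: an adjacency `R` on bonds (symmetric, neighbour lists `nbr` of size `≤ Δ`, steps of
`δ`-length `≤ r` for a pseudo-metric `δ`), lengths `ℓ ≥ 0` dominating the `δ`-diameter of EVERY polymer and `≤ r|X|` on connected ones, real activities `w_U X` with
`w_U ∅ = 0`, V-locality, vanishing off `R`-connected polymers and `|w_U X| ≤ E₀ q^{|X|}` on the window `W`; smallness `0 ≤ E₀ ≤ min N 1`, `0 ≤ q`,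
`(Δ+1)²·q·e^{1+κr} ≤ ½`, `κ ≥ 0`.  Conclusion: `∃ w̄ a ℓ` with the eight `KPGasOn` clauses (`w̄ X := E₀ q^{|X|}` on connected `X`, `a X := (min N 1)·|X|` by KPL-E
✓`exists_size_of_pinned_criterion`, pinned sum by §2).  Sibling spelling (graph-connected support, rate letter `δe^{−μ|X|}`, `δ + κℓ₀ + 2 log Δ + 1 ≤ μ`):
✓`…LargeFieldGasEntropyCriterion.exists_size_of_connected_decay` (p786644). [cite: KoteckyPreiss1986, Theorem p.492 (1); Balaban1989LargeFieldII, (1.97)-(1.100) pp.389-390] -/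
theorem kpGas_of_geometric {G : Type*} (R : B → B → Prop) (hRs : ∀ x y, R x y → R y x) (nbr : B → Finset B) (Δ : ℕ)
    (hΔ : ∀ x, (nbr x).card ≤ Δ) (hnbr : ∀ x y, R x y → y ∈ nbr x)
    (δ : B → B → ℝ) {r : ℝ} (ℓ : Finset B → ℝ) (hℓ0 : ∀ X, 0 ≤ ℓ X) (hℓδ : ∀ X : Finset B, ∀ e ∈ X, ∀ e' ∈ X, δ e e' ≤ ℓ X)
    (hℓr : ∀ X, IsRConnected R X → ℓ X ≤ r * (X.card : ℝ))
    (W : Set (B → G)) (w : (B → G) → Finset B → ℝ) (hw0 : ∀ U, w U ∅ = 0)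
    (hloc : ∀ (X : Finset B) (U U' : B → G), (∀ e ∈ X, U e = U' e) → w U X = w U' X)
    (hsupp : ∀ U, U ∈ W → ∀ X, ¬ IsRConnected R X → w U X = 0)
    {E₀ q κ N : ℝ} (hE₀ : 0 ≤ E₀) (hE₀N : E₀ ≤ N) (hE₀1 : E₀ ≤ 1) (hq : 0 ≤ q) (hκ : 0 ≤ κ)
    (hsmall : ((Δ : ℝ) + 1) ^ 2 * (q * Real.exp (1 + κ * r)) ≤ 1 / 2)
    (hbd : ∀ U, U ∈ W → ∀ X, IsRConnected R X → |w U X| ≤ E₀ * q ^ X.card) :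
    ∃ (wbar a ℓ' : Finset B → ℝ),
      (∀ U, w U ∅ = 0) ∧
      (∀ (X : Finset B) (U U' : B → G), (∀ e ∈ X, U e = U' e) → w U X = w U' X) ∧
      (∀ X, 0 ≤ a X) ∧ (∀ X, 0 ≤ ℓ' X) ∧
      (∀ U, U ∈ W → ∀ X, |w U X| ≤ wbar X) ∧
      (∀ X : Finset B, ∀ e ∈ X, ∀ e' ∈ X, δ e e' ≤ ℓ' X) ∧
      (∀ X : Finset B, ∑ X' ∈ Finset.univ.filter (fun X' => polyInc X' X), wbar X' * Real.exp (a X' + κ * ℓ' X') ≤ a X) ∧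
      (∀ e : B, a {e} ≤ N) := by
  classical
  set τ : ℝ := min N 1 with hτ
  have hτ0 : 0 ≤ τ := le_min (hE₀.trans hE₀N) zero_le_one
  have hEτ : E₀ ≤ τ := le_min hE₀N hE₀1
  set wbar : Finset B → ℝ := fun X => if IsRConnected R X then E₀ * q ^ X.card else 0 with hwbar
  have hw0' : ∀ X, 0 ≤ wbar X := fun X => by
    simp only [hwbar]; split_ifs
    · exact mul_nonneg hE₀ (pow_nonneg hq _)
    · exact le_rfl
  have hwe : wbar ∅ = 0 := by
    have : ¬ IsRConnected R (∅ : Finset B) := fun h => Finset.not_nonempty_empty h.1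
    simp only [hwbar, if_neg this]
  -- the pinned criterion at size `τ`
  have hlamle : q * Real.exp (τ + κ * r) ≤ q * Real.exp (1 + κ * r) :=
    mul_le_mul_of_nonneg_left (Real.exp_le_exp.2 (by linarith [min_le_right N 1])) hq
  have hsmallτ : ((Δ : ℝ) + 1) ^ 2 * (q * Real.exp (τ + κ * r)) ≤ 1 / 2 :=
    (mul_le_mul_of_nonneg_left hlamle (by positivity)).trans hsmall
  have hcrit : ∀ e : B, ∑ X' ∈ Finset.univ.filter (fun X' : Finset B => e ∈ X'),
      wbar X' * Real.exp (τ * (X'.card : ℝ) + κ * ℓ X') ≤ τ := by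
    intro e
    have h1 := pinnedSum_le_of_geometric R hRs nbr Δ hΔ hnbr hE₀ hq hκ hsmallτ wbar ℓ
      (fun X hX => by simp only [hwbar, if_pos hX]; exact le_rfl) (fun X hX => by simp only [hwbar, if_neg hX]; exact le_rfl) hℓr e
    -- `2λ ≤ 1` since `(Δ+1)² ≥ 1`, hence `E₀·2λ ≤ E₀ ≤ τ`
    have hΔ1 : (1 : ℝ) ≤ ((Δ : ℝ) + 1) ^ 2 := by
      have : (1 : ℝ) ≤ (Δ : ℝ) + 1 := by have := Nat.cast_nonneg (α := ℝ) Δ; linarith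
      nlinarith
    have hlam0 : 0 ≤ q * Real.exp (τ + κ * r) := mul_nonneg hq (Real.exp_pos _).le
    have h2 : 2 * (q * Real.exp (τ + κ * r)) ≤ 1 := by nlinarith
    calc _ ≤ E₀ * (2 * (q * Real.exp (τ + κ * r))) := h1
      _ ≤ E₀ * 1 := mul_le_mul_of_nonneg_left h2 hE₀
      _ ≤ τ := by rw [mul_one]; exact hEτ
  obtain ⟨a, ha, hKP, hpin⟩ :=
    Summit.QuantumFields.YangMills.Theorems.FluctuationComparisonRegPrIntLS2BetaKPLCriterion.exists_size_of_pinned_criterion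
      wbar ℓ κ hτ0 hw0' hwe hcrit
  refine ⟨wbar, a, ℓ, hw0, hloc, ha, hℓ0, fun U hU X => ?_, hℓδ, hKP, fun e => (hpin e).trans (min_le_left _ _)⟩
  by_cases hc : IsRConnected R X
  · simp only [hwbar, if_pos hc]; exact hbd U hU X hc
  · simp only [hwbar, if_neg hc, hsupp U hU X hc, abs_zero]; exact le_rfl

open Classical in
/-- ★★ **GEOMETRIC ACTIVITIES ⟹ `KPGasOn W κ N w` — THE `SU(2)` BOND-POLYMER EDITION, conclusion = LINE g19-2 §1c's `KPGasOn` (δ-unfolded) token for token.**  On the bond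
polymers of `(P)₀` with an adjacency `R` (symmetric, `≤ Δ` neighbours, steps of source-`tdist` `≤ r`), V-local real activities vanishing off `R`-connected polymers and bounded by
`E₀ q^{|X|}` on the window, with `0 ≤ E₀ ≤ min N 1`, `(Δ+1)²·q·e^{1+κr} ≤ ½`, form a Kotecký–Preiss gas on `W` at rate `κ ≥ 0` of one-bond size `≤ N`; the lengths are the
source diameters `ℓ X := max_{e,e′∈X} tdist(e.src, e′.src)` (§1 bounds them by `r(|X|−1)` on connected `X`). [cite: Balaban1989LargeFieldII, (1.97)-(1.100) pp.389-390; KoteckyPreiss1986, Theorem p.492 (1)] -/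
theorem kpGasOn_of_geometric {P : Params} (R : PBond P 0 → PBond P 0 → Prop) (hRs : ∀ x y, R x y → R y x)
    (nbr : PBond P 0 → Finset (PBond P 0)) (Δ : ℕ) (hΔ : ∀ x, (nbr x).card ≤ Δ) (hnbr : ∀ x y, R x y → y ∈ nbr x)
    {r : ℝ} (hr : 0 ≤ r) (hRr : ∀ x y, R x y → ((x.src.tdist y.src : ℕ) : ℝ) ≤ r)
    (W : Set (GaugeField P 0 (Matrix.specialUnitaryGroup (Fin 2) ℂ)))
    (w : GaugeField P 0 (Matrix.specialUnitaryGroup (Fin 2) ℂ) → Finset (PBond P 0) → ℝ) (hw0 : ∀ U, w U ∅ = 0)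
    (hloc : ∀ (X : Finset (PBond P 0)) (U U' : GaugeField P 0 (Matrix.specialUnitaryGroup (Fin 2) ℂ)), (∀ e ∈ X, U e = U' e) → w U X = w U' X)
    (hsupp : ∀ U, U ∈ W → ∀ X, ¬ IsRConnected R X → w U X = 0)
    {E₀ q κ N : ℝ} (hE₀ : 0 ≤ E₀) (hE₀N : E₀ ≤ N) (hE₀1 : E₀ ≤ 1) (hq : 0 ≤ q) (hκ : 0 ≤ κ)
    (hsmall : ((Δ : ℝ) + 1) ^ 2 * (q * Real.exp (1 + κ * r)) ≤ 1 / 2)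
    (hbd : ∀ U, U ∈ W → ∀ X, IsRConnected R X → |w U X| ≤ E₀ * q ^ X.card) :
    ∃ (wbar a ℓ : Finset (PBond P 0) → ℝ),
      (∀ U, w U ∅ = 0) ∧
      (∀ (X : Finset (PBond P 0)) (U U' : GaugeField P 0 (Matrix.specialUnitaryGroup (Fin 2) ℂ)), (∀ e ∈ X, U e = U' e) → w U X = w U' X) ∧
      (∀ X, 0 ≤ a X) ∧ (∀ X, 0 ≤ ℓ X) ∧
      (∀ U, U ∈ W → ∀ X, |w U X| ≤ wbar X) ∧
      (∀ X : Finset (PBond P 0), ∀ e ∈ X, ∀ e' ∈ X, (e.src.tdist e'.src : ℝ) ≤ ℓ X) ∧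
      (∀ X : Finset (PBond P 0), ∑ X' ∈ Finset.univ.filter (fun X' => polyInc X' X),
          wbar X' * Real.exp (a X' + κ * ℓ X') ≤ a X) ∧
      (∀ e : PBond P 0, a {e} ≤ N) := by
  -- the source diameter as the length
  set ℓ : Finset (PBond P 0) → ℝ := fun X => ((X.sup fun a => X.sup fun a' => a.src.tdist a'.src : ℕ) : ℝ) with hℓ
  have hℓ0 : ∀ X, 0 ≤ ℓ X := fun X => Nat.cast_nonneg _
  have hℓδ : ∀ X : Finset (PBond P 0), ∀ e ∈ X, ∀ e' ∈ X, ((e.src.tdist e'.src : ℕ) : ℝ) ≤ ℓ X := fun X e he e' he' =>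
    Summit.QuantumFields.YangMills.Theorems.FluctuationComparisonRegPrIntLPolymerPinAlgebra.cast_dist_le_cast_supDiam
      (fun a a' : PBond P 0 => a.src.tdist a'.src) X he he'
  have hℓr : ∀ X, IsRConnected R X → ℓ X ≤ r * (X.card : ℝ) := by
    intro X hX
    have hd : ∀ e ∈ X, ∀ e' ∈ X, ((e.src.tdist e'.src : ℕ) : ℝ) ≤ r * ((X.card : ℝ) - 1) := fun e he e' he' =>
      dist_le_of_isRConnected R (fun x y : PBond P 0 => ((x.src.tdist y.src : ℕ) : ℝ)) hr
        (fun x => by rw [B3Taylor310LocalRemainder.tdist_self]; simp)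
        (fun x y z => Summit.QuantumFields.YangMills.Theorems.FluctuationComparisonRegPrIntLS2BetaKPLogRep.tdist_src_triangle x y z)
        (fun x y hxy => ⟨hRr x y hxy, by rw [B3Taylor310LocalRemainder.tdist_comm]; exact hRr x y hxy⟩) hX he he'
    have hsup : (X.sup fun a => X.sup fun a' => a.src.tdist a'.src : ℕ) ≤ Nat.floor (r * ((X.card : ℝ) - 1)) := by
      refine Finset.sup_le fun a ha => Finset.sup_le fun a' ha' => ?_
      exact Nat.le_floor (hd a ha a' ha')
    have hr1 : 0 ≤ r * ((X.card : ℝ) - 1) := by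
      have : (1 : ℝ) ≤ X.card := by exact_mod_cast Finset.card_pos.2 hX.1
      nlinarith
    calc ℓ X ≤ (Nat.floor (r * ((X.card : ℝ) - 1)) : ℝ) := by simp only [hℓ]; exact_mod_cast hsup
      _ ≤ r * ((X.card : ℝ) - 1) := Nat.floor_le hr1
      _ ≤ r * (X.card : ℝ) := by nlinarith
  obtain ⟨wbar, a, ℓ', h1, h2, h3, h4, h5, h6, h7, h8⟩ := kpGas_of_geometric R hRs nbr Δ hΔ hnbr
    (fun x y : PBond P 0 => ((x.src.tdist y.src : ℕ) : ℝ)) ℓ hℓ0 hℓδ hℓr W w hw0 hloc hsupp hE₀ hE₀N hE₀1 hq hκ hsmall hbd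
  exact ⟨wbar, a, ℓ', h1, h2, h3, h4, h5, h6, h7, h8⟩

end Letter

end Summit.QuantumFields.YangMills.Theorems.KPGasOfGeometricActivities

end
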